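import Summits.BirchSwinnertonDyer.BirchSwinnertonDyer.Theorems.SignedLowerHalvesSmallImageLowerHalfBothSignsRttCharRoadE2JunctionJ2Closed
import Summits.BirchSwinnertonDyer.BirchSwinnertonDyer.Theorems.SignedLowerHalvesSmallImageLowerHalfBothSignsRttCharRoadE2OfIsUnitNsub
import Summits.BirchSwinnertonDyer.BirchSwinnertonDyer.Theorems.SignedLowerHalvesSmallImageLowerHalfBothSignsRttD2SkeletonTransport
import HarnessLib

/-!
# Route `SignedLowerHalves`, crux L `SmallImageLowerHalfBothSigns` (stmt-BirchSwinnertonDyer-23599), line `rtt_w3` v21 — E2, junction stub B′, row J2: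
# ★★★ ROW J2 FROM THE FRAME AND ONE NON-VANISHING — `hreg` and `htors` DISCHARGED

LEAD `cruxlead-stmt-BirchSwinnertonDyer-23599` g12 (helper `--supports stmt-BirchSwinnertonDyer-23599`). Sequel of p801130 (`junction_J2_of_hreg`): the two frame-side inputs
of the J2 socket — `htors : IsTorsion Λ_{𝒪,2} H²` and `hreg : ¬ char(H²) ≤ (T₂)` — are DERIVED from the conjuncts of the v21 frame (`CharRoadFrameProps`: honda's source skeleton
`D₀` with `Thm52Shape` (FACT `cor53_thm52ShapeO`), the `σ`-semilinear transport `e₀ e₁ e₂` to the twisted skeleton `Dθ` (`thm52Shape_of_semilinearEquiv`, p782462), `H¹[T₂] = 0`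
((4′), honda p798907), the 𝔞-unit `IsUnit (φ₀ (Dθ.nsub a))`) and ONE non-vanishing `hz : eH ζ̄_a ≠ 0` for some `Λ_𝒪`-linear map `eH : H¹₂ ⧸ T₂ → N` into a torsion-free
`Λ_𝒪`-module (in stub B′: `eH := j₀ ∘ s′`, `N := DQ.X ≅ Λ_𝒪`, `hz` from the reciprocity (7′) + `L ≠ 0`, exactly as inside the consumer p784139/p784278):
`hZ := Z_eq_cyclic_of_isUnit` (unit lift `isUnit_of_isUnit_map` at `b = 0`), `hdef := torsionBy_quotient_Z_eq_bot_of_quotSMulTop_linearMap` (p777666 lineage),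
`hreg := not_charIdeal_le_span_of_thm52Shape_of_torsionBy_eq_bot` (p782187), then the J2 socket (p786107) on honda's `s`/`δ₁` exactly as in p801130 — for ANY pinned
`Λ_𝒪`/`Λ`-structures (`hιH`, `hΛT`), so that B′'s assembler can `exact` it under the line file's `Module.compHom` pins.

* ★★★ `junction_J2_of_ne_zero` — `∃ s` (pinned levelwise by the corestriction) with `Module.Finite Λ (I.H ⧸ range s) ∧ IsTorsion Λ (I.H ⧸ range s) ∧ λ ≤ λ(H²₂[T₂])`.

THEOREMS ONLY; closes nothing by itself; crux L, crux M, E2, stub B′ and BSD remain OPEN and are proved for NO curve by any of this.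
References: [PerrinRiou1994Invent] §1.3; [JohnsonLeungKings2011] §4.2 Lemma 4.4, Thm. 5.2, §5.2, Cor. 5.3; [Washington1997] §13.2; [BourbakiAC5to7] VII §4.5.
-/

set_option autoImplicit false
-- the Theorems namespace of this sub repeats the summit name by design (D-0017 nested layout)
set_option linter.dupNamespace false

noncomputable section

open scoped NumberField
open Field IsDedekindDomain PowerSeries
open Literature.NumberTheory.GaloisRepresentations
open Literature.NumberTheory.EllipticCurves
open Literature.NumberTheory.ComplexMultiplication.EllipticUnits
open Literature.NumberTheory.ComplexMultiplication.EllipticUnits.JohnsonLeungKings2011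
open Summit.BirchSwinnertonDyer.BirchSwinnertonDyer.Theorems.SmallImageRttD2J1
open Summit.BirchSwinnertonDyer.BirchSwinnertonDyer.Theorems.SmallImageRttD2J2
open Summit.BirchSwinnertonDyer.BirchSwinnertonDyer.Theorems.SmallImageRttD2LamSpec
open Summit.BirchSwinnertonDyer.BirchSwinnertonDyer.Theorems.SmallImageRttD2Spec

namespace Summit.BirchSwinnertonDyer.BirchSwinnertonDyer.Theorems.SmallImageRttCharRoadJ2

universe v₀ w

variable {K : Type} [Field K] [NumberField K] {p : ℕ} [Fact p.Prime]

section J2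

variable (S : Set (PadicAlgCl p)) [FiniteDimensional ℚ_[p] (padicCoeffField S)] (κ₁ κ₂ : ZpExtension K p) {γ₁ γ₂ : absoluteGaloisGroup K}
  (θ : absoluteGaloisGroup K →ₜ* (padicCoeffIntegers S)ˣ) (𝔣 : Ideal (𝓞 K))

set_option maxHeartbeats 400000 in -- same budget line as the consumers p784139/p784278 (long binder lists, two pinned structures)
/-- ★★★ **Row J2 of the junction from the frame conjuncts and one non-vanishing.** Data: the frame's pair `hγ`, `𝔣 ≠ 0`, pinned two-variable models `D₀' D₁' D₂'`
(degrees 0,1,2), any cyclotomic model `I`; a source skeleton `D₀` with `Thm52Shape` on finitely generated carriers and its `σ`-semilinear transport `e₀ e₁ e₂` (with `haZ`) to a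
skeleton `Dθ` on `D₀'.H D₁'.H D₂'.H`; `H¹[T₂] = 0`; an index `a` with `IsUnit (φ₀ (Dθ.nsub a))`; pinned `Λ_𝒪`-structure on `H¹ ⧸ T₂` (`hιH`) and `Λ`-structure on `H²[T₂]`
(`hΛT`); a `Λ_𝒪`-linear `eH : H¹ ⧸ T₂ → N` into a torsion-free module with `eH ζ̄_a ≠ 0`. Conclusion: the J2 conjunct of stub B′ — `∃ s` (levelwise the corestriction) with
`coker s` finitely generated, `Λ`-torsion and `λ(coker s) ≤ λ(H²[T₂])`. [cite: PerrinRiou1994Invent, §1.3] [cite: JohnsonLeungKings2011, Thm. 5.2, §5.2, Cor. 5.3] [cite: Washington1997, §13.2] -/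
theorem junction_J2_of_ne_zero (hγ : ∃ u₁ u₂ : ℤ_[p]ˣ, ZpExtension.IsTopGeneratorPair (κ₁.unitTwist u₁) (κ₂.unitTwist u₂) γ₁ γ₂) (h𝔣 : 𝔣 ≠ ⊥)
    (D₀' : IwasawaCohomologyDataO S κ₁ κ₂ γ₁ γ₂ θ 𝔣 0) (D₁' : IwasawaCohomologyDataO S κ₁ κ₂ γ₁ γ₂ θ 𝔣 1) (D₂' : IwasawaCohomologyDataO S κ₁ κ₂ γ₁ γ₂ θ 𝔣 2)
    (I : CycIwasawaCohomologyDataO S κ₁ γ₁ θ (suppPF p 𝔣) 1)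
    -- the source skeleton and its transport (frame conjuncts 4–10)
    {Aidx : Type} {H0₀ H1₀ H2₀ : Type v₀} [AddCommGroup H0₀] [Module (IwasawaAlgebraO₂ S) H0₀] [AddCommGroup H1₀] [Module (IwasawaAlgebraO₂ S) H1₀]
    [AddCommGroup H2₀] [Module (IwasawaAlgebraO₂ S) H2₀] [Module.Finite (IwasawaAlgebraO₂ S) H1₀] [Module.Finite (IwasawaAlgebraO₂ S) H2₀]
    (D₀ : ZetaSkeleton (IwasawaAlgebraO₂ S) Aidx H0₀ H1₀ H2₀) (h52₀ : D₀.Thm52Shape)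
    (σ : IwasawaAlgebraO₂ S ≃+* IwasawaAlgebraO₂ S) (Dθ : ZetaSkeleton (IwasawaAlgebraO₂ S) Aidx D₀'.H D₁'.H D₂'.H)
    (e₀ : H0₀ ≃+ D₀'.H) (e₁ : H1₀ ≃+ D₁'.H) (he₁ : ∀ (r : IwasawaAlgebraO₂ S) (m : H1₀), e₁ (r • m) = σ r • e₁ m)
    (haZ : ∀ a' : Aidx, e₁ (D₀.aZeta a') = Dθ.aZeta a')
    (e₂ : H2₀ ≃+ D₂'.H) (he₂ : ∀ (r : IwasawaAlgebraO₂ S) (m : H2₀), e₂ (r • m) = σ r • e₂ m)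
    -- (4′) and the 𝔞-unit (frame conjuncts 15, 16)
    (hH1 : Submodule.torsionBy (IwasawaAlgebraO₂ S) D₁'.H
      (PowerSeries.C (PowerSeries.X - PowerSeries.C (0 : padicCoeffIntegers S)) : IwasawaAlgebraO₂ S) = ⊥)
    (a : Aidx) (ha : IsUnit (phi0 S (Dθ.nsub a)))
    -- pinned structures
    [Module (IwasawaAlgebraO S) (QuotSMulTop (PowerSeries.C (PowerSeries.X - PowerSeries.C (0 : padicCoeffIntegers S)) : IwasawaAlgebraO₂ S) D₁'.H)]
    (hιH : ∀ (l : IwasawaAlgebraO S) (x : QuotSMulTop (PowerSeries.C (PowerSeries.X - PowerSeries.C (0 : padicCoeffIntegers S)) : IwasawaAlgebraO₂ S) D₁'.H),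
      l • x = (PowerSeries.map (PowerSeries.C : padicCoeffIntegers S →+* IwasawaAlgebraO S) l) • x)
    [Module (IwasawaAlgebra p) (Submodule.torsionBy (IwasawaAlgebraO₂ S) D₂'.H
      (PowerSeries.C (PowerSeries.X - PowerSeries.C (0 : padicCoeffIntegers S)) : IwasawaAlgebraO₂ S))]
    (hΛT : ∀ (r : IwasawaAlgebra p) (x : Submodule.torsionBy (IwasawaAlgebraO₂ S) D₂'.H
        (PowerSeries.C (PowerSeries.X - PowerSeries.C (0 : padicCoeffIntegers S)) : IwasawaAlgebraO₂ S)),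
      r • x = (PowerSeries.map (PowerSeries.C : padicCoeffIntegers S →+* IwasawaAlgebraO S) (iwasawaToIwasawaO S r)) • x)
    -- the one non-vanishing (from the tails: `eH := j₀ ∘ s'`, `N := DQ.X`)
    {N : Type w} [AddCommGroup N] [Module (IwasawaAlgebraO S) N] [NoZeroSMulDivisors (IwasawaAlgebraO S) N]
    (eH : QuotSMulTop (PowerSeries.C (PowerSeries.X - PowerSeries.C (0 : padicCoeffIntegers S)) : IwasawaAlgebraO₂ S) D₁'.H →ₗ[IwasawaAlgebraO S] N)
    (hz : eH (zetaSp (PowerSeries.C (PowerSeries.X - PowerSeries.C (0 : padicCoeffIntegers S)) : IwasawaAlgebraO₂ S) Dθ a) ≠ 0) :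
    letI := I.moduleIwasawa
    haveI := I.isScalarTower_moduleIwasawa
    letI : Algebra (IwasawaAlgebra p) (IwasawaAlgebraO S) := (iwasawaToIwasawaO S).toAlgebra
    ∃ s : QuotSMulTop (PowerSeries.C (PowerSeries.X - PowerSeries.C (0 : padicCoeffIntegers S)) : IwasawaAlgebraO₂ S) D₁'.H →ₗ[IwasawaAlgebraO S] I.H,
      (∀ (n k : ℕ) (y : D₁'.H), I.proj n k (s (Submodule.Quotient.mk y)) = spLevel S κ₁ κ₂ θ 𝔣 n k 1 (D₁'.proj n k y)) ∧
      Module.Finite (IwasawaAlgebra p) (I.H ⧸ LinearMap.range s) ∧ Module.IsTorsion (IwasawaAlgebra p) (I.H ⧸ LinearMap.range s) ∧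
      lambdaInvariant p (I.H ⧸ LinearMap.range s) ≤
        lambdaInvariant p (Submodule.torsionBy (IwasawaAlgebraO₂ S) D₂'.H
          (PowerSeries.C (PowerSeries.X - PowerSeries.C (0 : padicCoeffIntegers S)) : IwasawaAlgebraO₂ S)) := by
  letI := I.moduleIwasawa
  haveI := I.isScalarTower_moduleIwasawa
  letI : Algebra (IwasawaAlgebra p) (IwasawaAlgebraO S) := (iwasawaToIwasawaO S).toAlgebra
  haveI : IsDiscreteValuationRing (padicCoeffIntegers S) := by
    rw [padicCoeffIntegers_eq_unitBall S]; exact LambdaLowerBoundO.isDiscreteValuationRing_unitBall p _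
  -- frame side: finiteness, Thm52Shape, torsion of H², `D.Z = D.cyclic a`, `hdef`, `hreg`
  haveI : Module.Finite (IwasawaAlgebraO₂ S) D₁'.H := moduleFinite_of_semilinearEquiv σ e₁ he₁
  haveI : Module.Finite (IwasawaAlgebraO₂ S) D₂'.H := moduleFinite_of_semilinearEquiv σ e₂ he₂
  have h52 : Dθ.Thm52Shape := thm52Shape_of_semilinearEquiv σ D₀ Dθ e₁ he₁ haZ e₀ e₂ he₂ h52₀
  have htors : Module.IsTorsion (IwasawaAlgebraO₂ S) D₂'.H := h52.1.2.2.2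
  have hZ : Dθ.Z = Dθ.cyclic a :=
    Z_eq_cyclic_of_isUnit Dθ a (SmallImageRttCharRoad.isUnit_of_isUnit_map (Ideal.zero_mem _) (phi0 S) (phi0_C_X_sub_C_zero S)
      (phi0_C_C S) (phi0_X S) ha)
  have hdef : Submodule.torsionBy (IwasawaAlgebraO₂ S) (D₁'.H ⧸ Dθ.Z)
      (PowerSeries.C (PowerSeries.X - PowerSeries.C (0 : padicCoeffIntegers S)) : IwasawaAlgebraO₂ S) = ⊥ :=
    SmallImageRttCharRoad.torsionBy_quotient_Z_eq_bot_of_quotSMulTop_linearMap (0 : padicCoeffIntegers S) (phi0 S) (phi0_C_C S) (phi0_X S)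
      (ker_phi0 S) Dθ a hZ hH1 hιH eH hz
  have hreg := SmallImageRttCharRoad.not_charIdeal_le_span_of_thm52Shape_of_torsionBy_eq_bot p S (0 : padicCoeffIntegers S) (phi0 S)
    (ker_phi0 S) Dθ h52 hdef
  -- the pair, ramification, finiteness of the support
  obtain ⟨hγ₁, hγu⟩ := SmallImageRttD2J2Delta.of_isTopGeneratorPair_unitTwist κ₁ κ₂ hγ
  have hV : ∀ m : ℕ, ramificationSubgroup K (suppPF p 𝔣) ≤ JohnsonLeungKings2011.pairLayerSubgroup κ₁ κ₂ m :=
    fun m ↦ PrintCf2.JLKDescent.ramificationSubgroup_suppPF_le_pairLayerSubgroup κ₁ κ₂ 𝔣 m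
  have hP : (suppPF p 𝔣).Finite := by
    refine Ideal.finite_factors (mul_ne_zero ?_ h𝔣)
    rw [Ne, Ideal.zero_eq_bot, Ideal.span_singleton_eq_bot]
    exact_mod_cast (Fact.out : p.Prime).ne_zero
  -- corestriction, specialisation, connecting map, socket
  obtain ⟨res, hres⟩ := exists_coresHom (S := S) D₁' I
  obtain ⟨s, hs⟩ := exists_specialisationLinearMap_frame_zero (D₂ := D₁') (D₁ := I) hres hγ₁ hιH
  refine ⟨s, fun n k y ↦ by rw [hs, hres], ?_⟩
  exact SmallImageRttCharRoad.junction_coker_of_exact₂ (S := S) (H2 := D₂'.H) (0 : padicCoeffIntegers S) (phi0 S)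
    (phi0_C_X_sub_C_zero S) (phi0_C_C S) (phi0_X S) (ker_phi0 S) htors hreg (fun _ ↦ rfl) hΛT s
    (SmallImageRttD2J2Delta.deltaTors S κ₁ κ₂ θ 𝔣 hγ₁ hγu hV D₂' I)
    (fun l x ↦ SmallImageRttD2J2Delta.deltaTors_smul S κ₁ κ₂ θ 𝔣 hγ₁ hγu hV D₂' I l x)
    (fun x ↦ by
      rw [SmallImageRttD2J2Delta.deltaTors_eq_zero_iff_mem_range S κ₁ κ₂ θ 𝔣 hγ₁ hγu hV D₁' D₂' I res hres hP
        (Submodule.Quotient.mk) (Submodule.Quotient.mk_surjective _) s hs x, LinearMap.mem_range, Set.mem_range])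

end J2

end Summit.BirchSwinnertonDyer.BirchSwinnertonDyer.Theorems.SmallImageRttCharRoadJ2

end
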